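import Literature.IUT.HodgeTheaters.InitialThetaData
import Mathlib.Topology.Instances.ZMod
import Mathlib.FieldTheory.Galois.Infinite
import Mathlib.Topology.Algebra.Category.ProfiniteGrp.Basic
import HarnessLib

/-!
# The `π₁`-interface of [IUTchI] Def. 3.1 (b)(d)(f) is inhabited over every profinite `G_F ⊇ G_K`
# (a profinite MODEL of `ThetaGeometry` / `PuncturedEllipticData` / `BadPlacePredicates`)

S. Mochizuki, *Inter-universal Teichmüller theory I*, RIMS manuscript (May 2020; = PRIMS **57** (2021)),
Def. 3.1 (a)–(f), kurims pp. 61–63; §1 p. 37 (the coverings `X̲_K → X_K`, `C̲_K → C_K`).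

The tree types the étale-fundamental-group clauses of Def. 3.1 as INTERFACE structures (abc-iut-L5-t2's
`ThetaGeometry GF GK l` over abc-iut-L5-t1's `PuncturedEllipticData` over abc-iut-L4-t1's
`FundamentalExtension` = a bare continuous surjection of profinite groups `Π ↠ G`; and the two local
predicates `BadPlacePredicates K`). Nothing in these types ties `Π` to a curve: they record the printed
INDEX / OPENNESS / SURJECTIVITY conditions only. This file makes that kernel-visible by CONSTRUCTING an
inhabitant for EVERY compact totally disconnected topological group `G_F`, closed subgroup `G_K ⊆ G_F` and
integer `l ≥ 5` prime to `6`: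

* `Π_{C_F} := G_F × (ℤ/2 × ℤ/l)` (finite discrete second factor), `Π_{X_F} := G_F × ({0} × ℤ/l)` — open,
  normal, of index `2`, surjecting onto `G_F`;
* `Π_{C_K} := G_K × (ℤ/2 × ℤ/l)` embedded by the inclusion, `Π_{X_K} = Π_{X_F} ∩ Π_{C_K}`,
  `Π_{C̲_K} := G_K × (ℤ/2 × {0})`, hence `Π_{X̲_K} = G_K × {0}`: `[Π_{X_K} : Π_{X̲_K}] = l`,
  `[Π_{C̲_K} : Π_{X̲_K}] = 2`, `Π_{C̲_K} ⊄ Π_{X_K}`, condition (∗) of [IUTchI] §1 trivially (the geometric part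
  `{1} × (ℤ/2 × ℤ/l)` is abelian), four cusp labels with decomposition group `G_K × {0}`;
* `BadPlacePredicates.trivial K := (⊤, ⊤)`.

CONSEQUENCE, recorded for the cell abc-iut (route `Summit.ABC.ABC.Theses.IUTThetaPilot`, crux `ThetaPartII`,
registered skeleton `ThetaPartII.Display`, child (i) `stub_thetaData : … → Cor22.ThetaDataExistsAt P l`): the
binders `Pb geom hbad_type hbad_cusp` of abc-iut-L5-t7's existence theorem
`exists_initialThetaData_of_conditions` are dischargeable by this model, so child (i) carries no `π₁`-content
AS TYPED (the numbers `−|log(Θ)|`, `−|log(q)|` of a Θ-volume datum never read `geom`); campaign-M statements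
quantified over these interfaces constrain Mochizuki's objects only through the listed axioms (by design of an
interface — the M-level constructors will supply the étale inhabitants). HONEST FRAMING: a MODEL of an
interface, not a claim about any curve; nothing here bears on [IUTchIII] Cor. 3.12; no side taken.
-/

noncomputable section

namespace Literature.IUT.HodgeTheaters

namespace ThetaGeometryModel

open Literature.AnabelianGeometry.AbsoluteAnabelian Topology

universe u

/-! ## The finite factor `ℤ/2 × ℤ/l` and its two subgroups -/

/-- The finite factor `ℤ/2 × ℤ/l` of the model, written multiplicatively (discrete topology).
[cite: Mochizuki2012, IUTchI §1 p.37] -/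
abbrev Fac (l : ℕ) : Type := Multiplicative (ZMod 2) × Multiplicative (ZMod l)

/-- The factor `{0} × ℤ/l` (models `Π_X ⊆ Π_C`, index `2`). [cite: Mochizuki2012, IUTchI §1 p.37] -/
def facX (l : ℕ) : Subgroup (Fac l) := (⊥ : Subgroup (Multiplicative (ZMod 2))).prod ⊤

/-- The factor `ℤ/2 × {0}` (models `Π_{C̲} ⊆ Π_C`, index `l`). [cite: Mochizuki2012, IUTchI §1 p.37] -/
def facC (l : ℕ) : Subgroup (Fac l) := (⊤ : Subgroup (Multiplicative (ZMod 2))).prod ⊥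

/-- `ℤ/2 × ℤ/l` has `2l` elements. [folklore] -/
private theorem card_fac (l : ℕ) [NeZero l] : Nat.card (Fac l) = 2 * l := by
  rw [Nat.card_prod, Nat.card_congr Multiplicative.toAdd, Nat.card_congr Multiplicative.toAdd,
    Nat.card_zmod, Nat.card_zmod]

/-- `[ℤ/2 × ℤ/l : {0} × ℤ/l] = 2`. [folklore] -/
private theorem facX_index (l : ℕ) [NeZero l] : (facX l).index = 2 := by
  rw [facX, Subgroup.index_prod, Subgroup.index_bot, Subgroup.index_top, mul_one,
    Nat.card_congr Multiplicative.toAdd, Nat.card_zmod]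

/-- `[ℤ/2 × ℤ/l : ℤ/2 × {0}] = l`. [folklore] -/
private theorem facC_index (l : ℕ) [NeZero l] : (facC l).index = l := by
  rw [facC, Subgroup.index_prod, Subgroup.index_bot, Subgroup.index_top, one_mul,
    Nat.card_congr Multiplicative.toAdd, Nat.card_zmod]

/-- `({0} × ℤ/l) ∩ (ℤ/2 × {0}) = {0}`. [folklore] -/
private theorem facX_inf_facC (l : ℕ) : facX l ⊓ facC l = ⊥ := by
  refine le_antisymm ?_ bot_le
  rintro ⟨a, b⟩ ⟨⟨ha, -⟩, ⟨-, hb⟩⟩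
  simp only [Subgroup.mem_bot] at ha hb ⊢
  exact Prod.ext ha hb

/-- `[{0} × ℤ/l : {0}] = l`. [folklore] -/
private theorem bot_relIndex_facX (l : ℕ) [NeZero l] : (⊥ : Subgroup (Fac l)).relIndex (facX l) = l := by
  have h := Subgroup.relIndex_mul_index (bot_le : (⊥ : Subgroup (Fac l)) ≤ facX l)
  rw [facX_index, Subgroup.index_bot, card_fac, mul_comm 2 l] at h
  exact Nat.eq_of_mul_eq_mul_right two_pos h

/-- `[ℤ/2 × {0} : {0}] = 2`. [folklore] -/
private theorem bot_relIndex_facC (l : ℕ) [NeZero l] : (⊥ : Subgroup (Fac l)).relIndex (facC l) = 2 := by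
  have h := Subgroup.relIndex_mul_index (bot_le : (⊥ : Subgroup (Fac l)) ≤ facC l)
  rw [facC_index, Subgroup.index_bot, card_fac] at h
  exact Nat.eq_of_mul_eq_mul_right (Nat.pos_of_ne_zero (NeZero.ne l)) h

/-- `ℤ/2 × {0} ⊄ {0} × ℤ/l` (the element `(1, 0)`). [folklore] -/
private theorem not_facC_le_facX (l : ℕ) : ¬ facC l ≤ facX l := by
  intro h
  have hmem : ((Multiplicative.ofAdd (1 : ZMod 2), (1 : Multiplicative (ZMod l))) : Fac l) ∈ facC l :=
    ⟨Subgroup.mem_top _, Subgroup.mem_bot.mpr rfl⟩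
  have h2 : Multiplicative.ofAdd (1 : ZMod 2) ∈ (⊥ : Subgroup (Multiplicative (ZMod 2))) :=
    (Subgroup.mem_prod.mp (h hmem)).1
  rw [Subgroup.mem_bot] at h2
  exact absurd (Multiplicative.ofAdd.injective h2) (by decide)

/-! ## The model arithmetic fundamental groups `G × (ℤ/2 × ℤ/l)` -/

section LiftSub

variable (G : Type u) [Group G] (l : ℕ)

/-- A subgroup `D` of the finite factor pulled back to `G × (ℤ/2 × ℤ/l)` (i.e. `G × D`).
[cite: Mochizuki2012, IUTchI §1 p.37] -/
def liftSub (D : Subgroup (Fac l)) : Subgroup (G × Fac l) := D.comap (MonoidHom.snd G (Fac l))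

variable {G l}

/-- Membership in `G × D` is membership of the second component in `D`. [folklore] -/
@[simp] private theorem mem_liftSub {D : Subgroup (Fac l)} {x : G × Fac l} : x ∈ liftSub G l D ↔ x.2 ∈ D := Iff.rfl

variable (G l)

/-- `[G × (ℤ/2 × ℤ/l) : G × D] = [ℤ/2 × ℤ/l : D]`. [folklore] -/
private theorem liftSub_index (D : Subgroup (Fac l)) : (liftSub G l D).index = D.index :=
  Subgroup.index_comap_of_surjective D Prod.snd_surjective

/-- Relative indices of pulled-back subgroups are those in the finite factor. [folklore] -/
private theorem liftSub_relIndex (D D' : Subgroup (Fac l)) :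
    (liftSub G l D).relIndex (liftSub G l D') = D.relIndex D' := by
  rw [liftSub, liftSub, Subgroup.relIndex_comap,
    Subgroup.map_comap_eq_self_of_surjective Prod.snd_surjective]

/-- Pull-back commutes with intersections. [folklore] -/
private theorem liftSub_inf (D D' : Subgroup (Fac l)) : liftSub G l (D ⊓ D') = liftSub G l D ⊓ liftSub G l D' :=
  Subgroup.comap_inf D D' _

/-- Pull-back is monotone. [folklore] -/
private theorem liftSub_mono {D D' : Subgroup (Fac l)} (h : D ≤ D') : liftSub G l D ≤ liftSub G l D' :=
  Subgroup.comap_mono h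

/-- `G × D` surjects onto `G` under the first projection (`(g, 1) ∈ G × D`). [folklore] -/
private theorem fst_liftSub_surjective (D : Subgroup (Fac l)) :
    Function.Surjective ((MonoidHom.fst G (Fac l)).comp (liftSub G l D).subtype) := by
  intro g
  exact ⟨⟨(g, 1), by simp⟩, rfl⟩

/-- The image of `G × D` under the first projection is all of `G`. [folklore] -/
private theorem map_fst_liftSub (D : Subgroup (Fac l)) : (liftSub G l D).map (MonoidHom.fst G (Fac l)) = ⊤ := by
  rw [eq_top_iff]
  intro g _
  exact ⟨(g, 1), by simp, rfl⟩

/-- In `G × (ℤ/2 × ℤ/l)` with `Π_X := G × ({0} × ℤ/l)` the commutator `g x g⁻¹ x⁻¹` of `g ∈ Π_X` with an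
element `x` of the geometric part `{1} × (ℤ/2 × ℤ/l)` is trivial (the finite factor is abelian) — so
condition (∗) of [IUTchI] §1 ("`G_k` acts trivially on `Δ_X^{ab} ⊗ ℤ/l`") holds in the model.
[cite: Mochizuki2012, IUTchI §1 p.37] -/
theorem comm_eq_one_of_fst_eq_one (g x : G × Fac l) (hx : x.1 = 1) : g * x * g⁻¹ * x⁻¹ = 1 := by
  obtain ⟨σ, d'⟩ := g
  obtain ⟨τ, d⟩ := x
  simp only at hx
  subst hx
  refine Prod.ext ?_ ?_
  · simp
  · show d' * d * d'⁻¹ * d⁻¹ = 1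
    rw [mul_inv_eq_one, mul_inv_eq_iff_eq_mul, mul_comm]

/-- `G × D` is open (the finite factor is discrete). [folklore] -/
private theorem isOpen_liftSub [TopologicalSpace G] (D : Subgroup (Fac l)) :
    IsOpen (liftSub G l D : Set (G × Fac l)) :=
  (isOpen_discrete (D : Set (Fac l))).preimage continuous_snd

end LiftSub

section Model

variable (G : Type u) [Group G] [TopologicalSpace G] [IsTopologicalGroup G] [CompactSpace G]
  [TotallyDisconnectedSpace G] (l : ℕ) [NeZero l]

/-- The model extension `G × (ℤ/2 × ℤ/l) ↠ G` (first projection) as a `FundamentalExtension`: models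
`Π_C ↠ G_k` with geometric part `Δ_C = {1} × (ℤ/2 × ℤ/l)`. [cite: Mochizuki2012, IUTchI Def. 3.1 (b) p.61] -/
def extOf : FundamentalExtension.{u} where
  arith := ProfiniteGrp.of (G × Fac l)
  gal := ProfiniteGrp.of G
  aug := ContinuousMonoidHom.fst G (Fac l)
  aug_surjective := Prod.fst_surjective

/-- **The model of [IUTchI] §1's data over `G`** (`PuncturedEllipticData`): `Π_C := G × (ℤ/2 × ℤ/l)`,
`Π_X := G × ({0} × ℤ/l)`, `Π_{C̲} := G × (ℤ/2 × {0})`, four cusp labels with decomposition group `G × {0}`.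
All printed index/openness/surjectivity conditions and (∗) hold. [cite: Mochizuki2012, IUTchI §1 p.37] -/
def pedOf (h5 : 5 ≤ l) (h6 : l.Coprime 6) : PuncturedEllipticData.{u} where
  l := l
  five_le := h5
  coprime_six := h6
  E := extOf G l
  PiX := liftSub G l (facX l)
  PiCbar := liftSub G l (facC l)
  isOpen_piX := isOpen_liftSub G l (facX l)
  isOpen_piCbar := isOpen_liftSub G l (facC l)
  index_piX := (liftSub_index G l (facX l)).trans (facX_index l)
  aug_piX := fst_liftSub_surjective G l (facX l)
  aug_piCbar := fst_liftSub_surjective G l (facC l)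
  star := by
    intro g _ x hx
    have h1 : x.1 = 1 := (FundamentalExtension.mem_geom _).mp hx.2
    have h0 : g * x * g⁻¹ * x⁻¹ = 1 := comm_eq_one_of_fst_eq_one G l g x h1
    rw [h0]
    exact Subgroup.one_mem _
  Cusp := ULift.{u} (Fin 4)
  decomp := fun _ => liftSub G l ⊥
  decomp_le := fun _ => le_inf (liftSub_mono G l bot_le) (liftSub_mono G l bot_le)
  ε0 := ⟨0⟩
  ε1 := ⟨1⟩
  ε2 := ⟨2⟩
  twoε := ⟨3⟩
  ε1_ne_ε0 := by decide
  ε2_ne_ε0 := by decide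
  ε1_ne_ε2 := by decide
  twoε_ne := by decide
  aug_decomp_twoε := fst_liftSub_surjective G l ⊥

/-- `Π_{X̲} = Π_X ∩ Π_{C̲}` of the model is `G × {0}`. [cite: Mochizuki2012, IUTchI §1 p.37] -/
theorem pedOf_PiXbar (h5 : 5 ≤ l) (h6 : l.Coprime 6) :
    (pedOf G l h5 h6).PiXbar = liftSub G l ⊥ := by
  show liftSub G l (facX l) ⊓ liftSub G l (facC l) = liftSub G l ⊥
  rw [← liftSub_inf, facX_inf_facC]

end Model

/-! ## The model of `ThetaGeometry G_F G_K l` -/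

section Theta

variable {GF : Type u} [Group GF] [TopologicalSpace GF] [IsTopologicalGroup GF] [CompactSpace GF]
  [TotallyDisconnectedSpace GF] (GK : Subgroup GF) (l : ℕ) [NeZero l]

/-- **The profinite model of the `π₁`-interface of [IUTchI] Def. 3.1 (b)(d)(f)** for a compact totally
disconnected group `G_F`, a closed subgroup `G_K` and `l ≥ 5` prime to `6`: `Π_{C_F} := G_F × (ℤ/2 × ℤ/l)`
with `G_F`-part the identity, `Π_{X_F} := G_F × ({0} × ℤ/l)`, the `K`-level data the model `pedOf` over `G_K`
embedded by the inclusion. Every field of `ThetaGeometry` holds. [cite: Mochizuki2012, IUTchI Def. 3.1 p.61–63] -/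
def geometryOf (hGK : IsClosed (GK : Set GF)) (h5 : 5 ≤ l) (h6 : l.Coprime 6) : ThetaGeometry GF GK l :=
  letI : CompactSpace GK := isCompact_iff_compactSpace.mp hGK.isCompact
  { extF := extOf GF l
    galIso := MulEquiv.refl GF
    galIso_continuous := ⟨continuous_id, continuous_id⟩
    PiX := liftSub GF l (facX l)
    PiX_isOpen := isOpen_liftSub GF l (facX l)
    PiX_normal := Subgroup.normal_comap _
    PiX_index := (liftSub_index GF l (facX l)).trans (facX_index l)
    aug_PiX := map_fst_liftSub GF l (facX l)
    pe := pedOf GK l h5 h6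
    pe_l := rfl
    embK := MonoidHom.prodMap GK.subtype (MonoidHom.id (Fac l))
    embK_continuous := continuous_subtype_val.prodMap continuous_id
    embK_injective := by
      rintro ⟨a, b⟩ ⟨c, d⟩ h
      have h1 := congrArg Prod.fst h
      have h2 := congrArg Prod.snd h
      exact Prod.ext (Subtype.ext h1) h2
    embK_range := by
      ext x
      constructor
      · rintro ⟨y, rfl⟩
        exact y.1.property
      · intro hx
        have hx' : x.1 ∈ GK := hx
        exact ⟨(⟨x.1, hx'⟩, x.2), Prod.ext rfl rfl⟩
    galKIso := MulEquiv.refl GK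
    aug_compat := fun _ => rfl
    embK_PiX := by
      ext x
      constructor
      · rintro ⟨y, hmem, rfl⟩
        exact ⟨hmem, y, rfl⟩
      · rintro ⟨hmem, y, hy⟩
        have h2 : y.2 = x.2 := congrArg Prod.snd hy
        have hmem' : x.2 ∈ facX l := hmem
        refine ⟨y, ?_, hy⟩
        show y.2 ∈ facX l
        rw [h2]
        exact hmem'
    PiXbar_relIndex := by
      rw [pedOf_PiXbar]
      show (liftSub GK l ⊥).relIndex (liftSub GK l (facX l)) = l
      rw [liftSub_relIndex, bot_relIndex_facX]
    aug_PiXbar := by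
      rw [pedOf_PiXbar]
      exact fst_liftSub_surjective GK l ⊥
    PiXbar_relIndex_PiCbar := by
      rw [pedOf_PiXbar]
      show (liftSub GK l ⊥).relIndex (liftSub GK l (facC l)) = 2
      rw [liftSub_relIndex, bot_relIndex_facC]
    not_PiCbar_le_PiX := by
      intro h
      apply not_facC_le_facX l
      intro d hd
      have : ((1 : GK), d) ∈ liftSub GK l (facX l) := h (show ((1 : GK), d) ∈ liftSub GK l (facC l) from hd)
      exact this }

/-- **`ThetaGeometry G_F G_K l` is inhabited** for every compact totally disconnected topological group `G_F`,
closed subgroup `G_K` and `l ≥ 5` prime to `6`. [cite: Mochizuki2012, IUTchI Def. 3.1 p.61–63] -/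
theorem nonempty_thetaGeometry (hGK : IsClosed (GK : Set GF)) (h5 : 5 ≤ l) (h6 : l.Coprime 6) :
    Nonempty (ThetaGeometry GF GK l) :=
  ⟨geometryOf GK l hGK h5 h6⟩

end Theta

/-! ## The Galois case `G_F = Gal(F̄/F) ⊇ G_K = Gal(F̄/K)` -/

section Galois

variable (F K Fbar : Type*) [Field F] [Field K] [Field Fbar] [Algebra F K] [Algebra F Fbar] [Algebra K Fbar]
  [IsScalarTower F K Fbar]

/-- `G_K = Gal(F̄/K) ⊆ Gal(F̄/F)` is the fixing subgroup of the intermediate field `K ⊆ F̄`.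
[cite: Mochizuki2012, IUTchI Def. 3.1 (e) p.62] -/
theorem galoisSubgroupOf_eq_fixingSubgroup :
    galoisSubgroupOf F K Fbar = ((IsScalarTower.toAlgHom F K Fbar).fieldRange).fixingSubgroup := by
  ext σ
  rw [IntermediateField.mem_fixingSubgroup_iff]
  constructor
  · rintro hσ x ⟨y, rfl⟩
    exact hσ y
  · intro hσ y
    exact hσ _ ⟨y, rfl⟩

/-- `G_K` is closed in `Gal(F̄/F)` for the Krull topology when `F̄/F` is Galois.
[cite: Mochizuki2012, IUTchI Def. 3.1 (e) p.62] -/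
theorem isClosed_galoisSubgroupOf [IsGalois F Fbar] : IsClosed (galoisSubgroupOf F K Fbar : Set (Fbar ≃ₐ[F] Fbar)) := by
  rw [galoisSubgroupOf_eq_fixingSubgroup]
  exact InfiniteGalois.fixingSubgroup_isClosed _

/-- **The `π₁`-interface of [IUTchI] Def. 3.1 is inhabited in the Galois case**: for a Galois extension `F̄/F`,
any intermediate field `K` (as an `F`-algebra inside `F̄`) and `l ≥ 5` prime to `6`,
`ThetaGeometry (F̄ ≃ₐ[F] F̄) G_K l` is nonempty. [cite: Mochizuki2012, IUTchI Def. 3.1 p.61–63] -/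
theorem nonempty_thetaGeometry_galois [IsGalois F Fbar] {l : ℕ} (h5 : 5 ≤ l) (h6 : l.Coprime 6) :
    Nonempty (ThetaGeometry (Fbar ≃ₐ[F] Fbar) (galoisSubgroupOf F K Fbar) l) :=
  haveI : NeZero l := ⟨by omega⟩
  nonempty_thetaGeometry (galoisSubgroupOf F K Fbar) l (isClosed_galoisSubgroupOf F K Fbar) h5 h6

end Galois

end ThetaGeometryModel

/-- The TRIVIAL bad-place predicates (both `⊤`): an inhabitant of the interface `BadPlacePredicates K` of
[IUTchI] Def. 3.1 (e)(f) under which the side conditions `hbad_type`, `hbad_cusp` of the constructors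
`InitialThetaData.ofArith` / `exists_initialThetaData_of_conditions` hold vacuously.
[cite: Mochizuki2012, IUTchI Def. 3.1 (e)(f) p.62–63] -/
def BadPlacePredicates.trivial (K : Type*) [Field K] [NumberField K] : BadPlacePredicates K :=
  ⟨fun _ => True, fun _ => True⟩

/-- Both trivial predicates hold everywhere. [cite: Mochizuki2012, IUTchI Def. 3.1 (e)(f) p.62–63] -/
theorem BadPlacePredicates.trivial_holds (K : Type*) [Field K] [NumberField K] (w : Val K) :
    (BadPlacePredicates.trivial K).IsTypeOneZModLPM w ∧ (BadPlacePredicates.trivial K).IsCanonicalGeneratorCusp w :=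
  ⟨True.intro, True.intro⟩

end Literature.IUT.HodgeTheaters

end
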